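import Mathlib
import Literature.MathematicalPhysics.QuantumFieldTheory.Luscher2010.FlowActionSeriesProofs
import Summits.Ventures.LatticeQCDFlow.TrivializingMaps.SlotCasimir

/-!
# Coefficient functions of slot representations: link derivatives and Lüscher's Laplacian

HONEST FRAMING. Exact (Metropolis-corrected) sampling algorithms for lattice gauge theory; figures of
merit are autocorrelation/cost numbers at stated couplings and volumes; no continuum-physics claim.
This file is pure matrix calculus (no measure theory, no physics).

A **coefficient function** of the slot representation `R_σ` (`SlotRepresentation.slotRep`) with kernel
`a : (σ → Fin n) → (σ → Fin n) → ℂ` is `W ↦ Re ∑_{I,J} a_{IJ} R_σ(W)_{IJ}` (every term of Lüscher's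
`S̃^{(k)}` is of this form, THEORY-1 §19.1).  We prove, in the TREE's conventions
(`Luscher2010.linkDeriv`, `Luscher2010.linkLap`, curves `s ↦ exp((s:ℂ)•X) W(e)`):

* `linkDeriv_coeff` : `∂_{e,Y} coeff(a) = coeff(a ⋆ T^{σ,e}_Y)` — a link derivative of a coefficient
  function is the coefficient function of the kernel contracted with the slot generator
  (`SlotRepresentation.slotGen`); in particular coefficient functions are closed under `∂_{e,Y}`;
* `linkLap_coeff` : `Δ coeff(a) = coeff(a ⋆ ∑_e C^{σ,e})` — Lüscher's link Laplacian acts on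
  coefficient functions through the total slot Casimir (`SlotCasimir.casimirM`).

These are the two identities that make the Casimir-graded recursion of THEORY-1 §19.3 an instance of
`IsLuscherSeries` (file (5) of §19.5).  [folklore matrix calculus; conventions of
Luscher2010Trivializing §2.2 eq. (2.2), §4.2 eq. (4.6)]
-/

namespace Summit.Ventures.LatticeQCDFlow.TrivializingMaps.SlotCoefficient

open Literature.MathematicalPhysics.QuantumFieldTheory
open Literature.MathematicalPhysics.QuantumFieldTheory.Luscher2010
open SlotRepresentation SlotCasimir
open scoped ComplexConjugate

variable {d L n : ℕ} {σ : Type*} [Fintype σ] [DecidableEq σ]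

/-! ## 1. Kernels, coefficient functions, contraction -/

/-- Kernels `a_{IJ}` on slot multi-indices. [folklore] -/
abbrev Kernel (σ : Type*) (n : ℕ) : Type _ := (σ → Fin n) → (σ → Fin n) → ℂ

/-- The complex coefficient function `W ↦ ∑_{I,J} a_{IJ} R_σ(W)_{IJ}`. [folklore] -/
def coeffC (lnk : σ → Edge d L) (pol : σ → Bool) (a : Kernel σ n) (W : AmbConfig d L n) : ℂ :=
  ∑ I, ∑ J, a I J * slotRep lnk pol W I J

/-- The (real) **coefficient function** `W ↦ Re ∑_{I,J} a_{IJ} R_σ(W)_{IJ}`. [folklore] -/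
def coeff (lnk : σ → Edge d L) (pol : σ → Bool) (a : Kernel σ n) : AmbConfig d L n → ℝ :=
  fun W => (coeffC lnk pol a W).re

/-- Contraction of a kernel with a matrix on the left multi-index:
`(a ⋆ G)_{KJ} = ∑_I a_{IJ} G_{IK}`. [folklore] -/
def contract (a : Kernel σ n) (G : Matrix (σ → Fin n) (σ → Fin n) ℂ) : Kernel σ n :=
  fun K J => ∑ I, a I J * G I K

/-- `∑_{I,J} a_{IJ} (G R)_{IJ} = ∑_{K,J} (a ⋆ G)_{KJ} R_{KJ}`. [folklore] -/
theorem sum_mul_mul_eq (a : Kernel σ n) (G R : Matrix (σ → Fin n) (σ → Fin n) ℂ) :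
    ∑ I, ∑ J, a I J * (G * R) I J = ∑ K, ∑ J, contract a G K J * R K J := by
  simp only [contract, Matrix.mul_apply, Finset.mul_sum, Finset.sum_mul, mul_assoc]
  conv_lhs => rw [Finset.sum_comm]
  conv_rhs => rw [Finset.sum_comm]
  exact Finset.sum_congr rfl fun J _ => Finset.sum_comm

/-- Iterated contraction is contraction with the product. [folklore] -/
theorem contract_contract (a : Kernel σ n) (G G' : Matrix (σ → Fin n) (σ → Fin n) ℂ) :
    contract (contract a G) G' = contract a (G * G') := by
  funext K J
  simp only [contract, Matrix.mul_apply, Finset.sum_mul, Finset.mul_sum, mul_assoc]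
  exact Finset.sum_comm

/-- Contraction is additive in the matrix: negation. [folklore] -/
theorem contract_neg (a : Kernel σ n) (G : Matrix (σ → Fin n) (σ → Fin n) ℂ) :
    contract a (-G) = -contract a G := by
  funext K J
  simp [contract, Finset.sum_neg_distrib, mul_neg]

/-- Contraction is additive in the matrix: finite sums. [folklore] -/
theorem contract_sum {κ : Type*} (s : Finset κ) (a : Kernel σ n)
    (G : κ → Matrix (σ → Fin n) (σ → Fin n) ℂ) :
    contract a (∑ i ∈ s, G i) = ∑ i ∈ s, contract a (G i) := by
  funext K J
  simp only [contract, Finset.sum_apply, Matrix.sum_apply, Finset.mul_sum]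
  exact Finset.sum_comm

/-- The coefficient function is additive in the kernel: negation. [folklore] -/
theorem coeffC_neg (lnk : σ → Edge d L) (pol : σ → Bool) (a : Kernel σ n) (W : AmbConfig d L n) :
    coeffC lnk pol (-a) W = -coeffC lnk pol a W := by
  simp [coeffC, Finset.sum_neg_distrib, neg_mul]

/-- The coefficient function is additive in the kernel: finite sums. [folklore] -/
theorem coeffC_sum {κ : Type*} (s : Finset κ) (lnk : σ → Edge d L) (pol : σ → Bool)
    (a : κ → Kernel σ n) (W : AmbConfig d L n) :
    coeffC lnk pol (∑ i ∈ s, a i) W = ∑ i ∈ s, coeffC lnk pol (a i) W := by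
  simp only [coeffC, Finset.sum_apply, Finset.sum_mul]
  symm
  rw [Finset.sum_comm]
  exact Finset.sum_congr rfl fun I _ => Finset.sum_comm

/-- Real coefficient function: negation. [folklore] -/
theorem coeff_neg (lnk : σ → Edge d L) (pol : σ → Bool) (a : Kernel σ n) (W : AmbConfig d L n) :
    coeff lnk pol (-a) W = -coeff lnk pol a W := by
  simp [coeff, coeffC_neg]

/-- Real coefficient function: finite sums. [folklore] -/
theorem coeff_sum {κ : Type*} (s : Finset κ) (lnk : σ → Edge d L) (pol : σ → Bool)
    (a : κ → Kernel σ n) (W : AmbConfig d L n) :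
    coeff lnk pol (∑ i ∈ s, a i) W = ∑ i ∈ s, coeff lnk pol (a i) W := by
  simp [coeff, coeffC_sum, Complex.re_sum]

/-! ## 2. Link derivatives of coefficient functions -/

/-- Derivative of the complex coefficient function along `t ↦ exp(tY) W(e)`. [folklore] -/
theorem hasDerivAt_coeffC (lnk : σ → Edge d L) (pol : σ → Bool) (a : Kernel σ n)
    (W : AmbConfig d L n) (e : Edge d L) (Y : Matrix (Fin n) (Fin n) ℂ) :
    HasDerivAt (fun t : ℝ => coeffC lnk pol a
        (Function.update W e (NormedSpace.exp (t • Y) * W e)))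
      (coeffC lnk pol (contract a (slotGen lnk pol e Y)) W) 0 := by
  have h := hasDerivAt_sum_mul_slotRep lnk pol W e Y a
  rw [sum_mul_mul_eq] at h
  exact h

/-- The tree's curve parameter: `exp((s:ℂ)•Y) = exp(s•Y)` for real `s`. [folklore] -/
theorem exp_coe_smul (s : ℝ) (Y : Matrix (Fin n) (Fin n) ℂ) :
    NormedSpace.exp ((s : ℂ) • Y) = NormedSpace.exp (s • Y) := by
  rw [Complex.coe_smul]

/-- Real part of a differentiable complex curve. [folklore] -/
theorem hasDerivAt_re {f : ℝ → ℂ} {f' : ℂ} {x : ℝ} (hf : HasDerivAt f f' x) :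
    HasDerivAt (fun t => (f t).re) f'.re x :=
  Complex.reCLM.hasFDerivAt.comp_hasDerivAt x hf

/-- **Link derivative of a coefficient function** (tree convention `Luscher2010.linkDeriv`):
`∂_{e,Y} coeff(a) (W) = coeff(a ⋆ T^{σ,e}_Y) (W)`.  [folklore; conventions of Luscher2010Trivializing
§2.2 eq. (2.2)] -/
theorem linkDeriv_coeff (lnk : σ → Edge d L) (pol : σ → Bool) (a : Kernel σ n) (e : Edge d L)
    (Y : Matrix (Fin n) (Fin n) ℂ) (W : AmbConfig d L n) :
    linkDeriv e Y (coeff lnk pol a) W = coeff lnk pol (contract a (slotGen lnk pol e Y)) W := by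
  have h := hasDerivAt_re (hasDerivAt_coeffC lnk pol a W e Y)
  have hfun : (fun s : ℝ => coeff lnk pol a
      (Function.update W e (NormedSpace.exp ((s : ℂ) • Y) * W e)))
      = fun s : ℝ => (coeffC lnk pol a
          (Function.update W e (NormedSpace.exp (s • Y) * W e))).re := by
    funext s
    rw [exp_coe_smul]
    rfl
  unfold linkDeriv
  rw [hfun]
  exact h.deriv

/-- Coefficient functions are closed under link derivatives (as functions). [folklore] -/
theorem linkDeriv_coeff_fun (lnk : σ → Edge d L) (pol : σ → Bool) (a : Kernel σ n) (e : Edge d L)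
    (Y : Matrix (Fin n) (Fin n) ℂ) :
    linkDeriv e Y (coeff lnk pol a) = coeff lnk pol (contract a (slotGen lnk pol e Y)) :=
  funext fun W => linkDeriv_coeff lnk pol a e Y W

/-! ## 3. Lüscher's Laplacian on coefficient functions -/

/-- **Lüscher's link Laplacian of a coefficient function** (tree convention `Luscher2010.linkLap`,
`Δ = -∑_e ∑_a ∂^a_e ∂^a_e`): `Δ coeff(a) (W) = coeff(a ⋆ ∑_e C^{σ,e}) (W)` with the slot Casimirs
`C^{σ,e} = -∑_a (T^{σ,e}_a)²` (`SlotCasimir.casimirM`).  [folklore; conventions of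
Luscher2010Trivializing §4.2 eq. (4.6)] -/
theorem linkLap_coeff [NeZero L] (B : SuBasis n) (lnk : σ → Edge d L) (pol : σ → Bool)
    (a : Kernel σ n) (W : AmbConfig d L n) :
    linkLap B (coeff lnk pol a) W
      = coeff lnk pol (contract a (∑ e : Edge d L, casimirM B lnk pol e)) W := by
  unfold linkLap
  simp_rw [linkDeriv_coeff_fun, contract_contract]
  rw [contract_sum, coeff_sum]
  simp only [casimirM, contract_neg, contract_sum, coeff_neg, coeff_sum, Finset.sum_neg_distrib]

end Summit.Ventures.LatticeQCDFlow.TrivializingMaps.SlotCoefficient
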